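import Summits.AtomisticToContinuum.Crystallization.Theses.PricedLinkCensus
import Literature.Geometry.DiscreteGeometry.FejesTothKissingTwelve
import Summits.AtomisticToContinuum.Crystallization.Theorems.PricedLinkCensusSoftLayerPropagationStubChartAssembly
import Summits.AtomisticToContinuum.Crystallization.Theorems.PricedLinkCensusSoftLayerPropagationStubLinkEdges
import Summits.AtomisticToContinuum.Crystallization.Theorems.PricedLinkCensusSoftLayerPropagationBasics

/-!
# Skeleton — crux `PricedLinkCensus.SoftLayerPropagation` (stmt-AtomisticToContinuum-14233),
# line `twin-cone` (crux-strategist ALTERNATIVE line, 2026-08-17; the live line is `Sketch`)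

## Idea

The live line `Sketch` (leads c1/c2) has landed the whole exact DEVELOPMENT of the shadow crystal
(charts, exact transitions, `develop_HO/HX/H1R`) and is left with `stub_oneStacking` — whose
architecture note says the global step needs hypothesis radius ≈ `12·nn` because the landed
η = 0 engine `stub_ballPropagation` has radii `13 → 7` (contact-`2` units) — and the sharp
`stub_metric`.  This line closes the SAME crux at the crux's radius `8·nn` by three moves:

1. **Staircase engine.**  The exact (η = 0) double-twin obstruction is a STAIRCASE, not a ratio:
   among all three-grain configurations (two coherent Σ3 twin planes of one fcc grain meeting on a
   `[1,-1,0]` junction row, any third boundary) a centre whose charge-free radius exceeds `2.85·nn`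
   never sees foreign sites of both grains within `√11·nn = 3.3166·nn` (kit job j023867, exact
   integer geometry, 6 configurations × 4 300 centres; the curve `r*(R)` is `2.517 | 3.317 | 4.082 |
   4.933 | 6.532` on `R ∈ (2, 2.85] | (2.85, 4.2] | (4.25, 5.65] | (5.7, 6.6] | (6.65, …)`).  Hence
   the finite-ball layer propagation holds with radii `71/10 → 13/2` (contact-`2` units; `3.55 →
   3.25` in `nn`), ratio `1.09` instead of `1.86`: `stub_ballPropagationLow`.
2. **Real-ball development + coarse tracking.**  The development is re-exported on the REAL
   `(51/10)·nn_i`-ball (`stub_developReal`; the landed `develop_reduction` runs with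
   `R₁ = 129/25·nn_i`, only its final restriction to bond walks of length `≤ 5` loses the factor
   `√(3/2)`), and a COARSE metric stub (`stub_shadowCoarse`: shadow packing, global bond-faithfulness,
   one-sided tracking constants `1/4` (inward, radius `3`) and `2/5` (outward, shadow radius `4`),
   scale drift `≤ 10 %`) feeds the engine: shells are exact at every shadow point within `3.55` of
   `D i` because such a site is within `(3.55 + 2/5 + 1.01·1.1)·nn_i = 5.06·nn_i < 5.1·nn_i`.
3. **Labels, then licence.**  `stub_oneStackingLow` (formalisation: scale the shadow by `2`,
   Mazur–Ulam, pull back) turns the engine's set identity into ONE unit Barlow stacking carrying the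
   shadow `13/4`-ball and exhausting it; with the coarse constants this is exactly the labelling
   `BarlowBallLabelling` (container `4`), and the sharp metric step is asked in LABEL form,
   `stub_licence` (= `LabelledLicence`: given ANY injective bond-faithful unit-Barlow labelling,
   one rigid motion is `nn_i/6`-accurate on the sites with real distance `≤ 3·nn_i` or label within
   `19/6`), so that an LP/SDP dual certificate can be computed on the reference stacking.

Composition `SoftLayerPropagation_of` below is sorry-free: charts (landed `stub_chartAssembly`,
`stub_linkEdges`, stub `stub_softLink`) → `stub_developReal` → `stub_shadowCoarse` →
`stub_oneStackingLow` (fed `stub_ballPropagationLow`) → labels `L j := φ (D j)` satisfy the four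
clauses of `BarlowBallLabelling` → `stub_licence` → the crux, by the strategist's split glue (the proof of
`Theorems.SoftLayerPropagation_of_subs` in `Cruxes/…/SplitGlue.lean`, inlined with container `4`).

Disproof used (Cruxes/SoftLayerPropagation/Disproof.lean v5): `softLayerPropagation_false_without_ball`
/ `_radius_threeHalves` — honoured: `stub_developReal`, `stub_shadowCoarse` and the engine consume
charge-freeness out to `5.1·nn_i` (+ charts to `8·nn_i`); `softLayerPropagation_tolerance_lb`
(`¬ SLP 8 3 (1/20)`) — honoured: the only stub with the tolerance `1/6` is `stub_licence`, stated
at `1/6` with the strain family as its recorded near-miss; `softLayerPropagation_false_radius_twin`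
(`¬ SLP (14/5) 3 (1/6)`, T-junction) — this line's engine is built on the SAME obstruction family,
extended to the full staircase (the T-junction is the `R ≤ 2.83` step: `r* = 2.517 < 3`).
-/

noncomputable section

namespace Summit.AtomisticToContinuum.Crystallization.Cruxes.SoftLayerPropagation.TwinCone

open Literature.Geometry.DiscreteGeometry Literature.MathematicalPhysics.StatisticalMechanics

/-! ## Registered stubs (`sorry` only here; signatures fully inlined) -/

/-- **stub_softLink** (SHARED VERBATIM with line `Sketch`; conditional version landed as
`Theorems.stub_softLink_of_tammes13 : musinTarasov2012_tammes_thirteen → …`, p127877): the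
twelve-point soft link theorem — a soft `4`-regular link at `η ≤ 1/100` is `1/4`-matched to a
rotated cuboctahedron / anticuboctahedron. -/
theorem stub_softLink : ∀ η : ℝ, 0 < η → η ≤ 1 / 100 →
      ∀ (z : Fin 12 → EuclideanSpace ℝ (Fin 3)) (n : Fin 12 → ℝ),
        (∀ j, 1 ≤ ‖z j‖) →
        (∀ j, ‖z j‖ ≤ (1 + η) * min 1 (n j)) →
        (∀ j, n j ≤ ‖z j‖) →
        (∀ j k, j ≠ k → n j ≤ dist (z j) (z k)) →
        (∀ j, (Finset.univ.filter (fun k : Fin 12 =>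
            k ≠ j ∧ dist (z j) (z k) ≤ (1 + η) * min (n j) (n k))).card = 4) →
        ∃ (A : EuclideanSpace ℝ (Fin 3) →ₗᵢ[ℝ] EuclideanSpace ℝ (Fin 3))
          (P : Finset (EuclideanSpace ℝ (Fin 3))),
          (P = Literature.Geometry.DiscreteGeometry.fccKissingPattern ∨
            P = Literature.Geometry.DiscreteGeometry.hcpKissingPattern) ∧
            ∀ p ∈ P, ∃ j : Fin 12, dist (z j) (A p) ≤ 1 / 4 := by
  sorry

/-- **stub_linkEdges** (LANDED, `Theorems.stub_linkEdges`, p90764): no bond of a `1/4`-matched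
soft link runs along a square diagonal of the pattern. -/
theorem stub_linkEdges : ∀ η : ℝ, 0 < η → η ≤ 1 / 100 →
      ∀ (z : Fin 12 → EuclideanSpace ℝ (Fin 3)) (n : Fin 12 → ℝ),
        (∀ j, 1 ≤ ‖z j‖) →
        (∀ j, ‖z j‖ ≤ (1 + η) * min 1 (n j)) →
        (∀ j, n j ≤ ‖z j‖) →
        (∀ j k, j ≠ k → n j ≤ dist (z j) (z k)) →
        (∀ j, (Finset.univ.filter (fun k : Fin 12 =>
            k ≠ j ∧ dist (z j) (z k) ≤ (1 + η) * min (n j) (n k))).card = 4) →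
        ∀ (A : EuclideanSpace ℝ (Fin 3) →ₗᵢ[ℝ] EuclideanSpace ℝ (Fin 3))
          (P : Finset (EuclideanSpace ℝ (Fin 3))),
          (P = Literature.Geometry.DiscreteGeometry.fccKissingPattern ∨
            P = Literature.Geometry.DiscreteGeometry.hcpKissingPattern) →
          (∀ p ∈ P, ∃ j : Fin 12, dist (z j) (A p) ≤ 1 / 4) →
          ∀ p ∈ P, ∀ q ∈ P, ∀ j k : Fin 12,
            dist (z j) (A p) ≤ 1 / 4 → dist (z k) (A q) ≤ 1 / 4 → j ≠ k →
            dist (z j) (z k) ≤ (1 + η) * min (n j) (n k) → dist p q = 1 := by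
  exact Summit.AtomisticToContinuum.Crystallization.Theorems.stub_linkEdges

/-- **stub_chartAssembly** (LANDED, `Theorems.stub_chartAssembly`, p87977): exact labelled charts
at every charge-free site of positive scale. -/
theorem stub_chartAssembly : (∀ η : ℝ, 0 < η → η ≤ 1 / 100 →
      ∀ (z : Fin 12 → EuclideanSpace ℝ (Fin 3)) (n : Fin 12 → ℝ),
        (∀ j, 1 ≤ ‖z j‖) →
        (∀ j, ‖z j‖ ≤ (1 + η) * min 1 (n j)) →
        (∀ j, n j ≤ ‖z j‖) →
        (∀ j k, j ≠ k → n j ≤ dist (z j) (z k)) →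
        (∀ j, (Finset.univ.filter (fun k : Fin 12 =>
            k ≠ j ∧ dist (z j) (z k) ≤ (1 + η) * min (n j) (n k))).card = 4) →
        ∃ (A : EuclideanSpace ℝ (Fin 3) →ₗᵢ[ℝ] EuclideanSpace ℝ (Fin 3))
          (P : Finset (EuclideanSpace ℝ (Fin 3))),
          (P = Literature.Geometry.DiscreteGeometry.fccKissingPattern ∨
            P = Literature.Geometry.DiscreteGeometry.hcpKissingPattern) ∧
            ∀ p ∈ P, ∃ j : Fin 12, dist (z j) (A p) ≤ 1 / 4) →
    (∀ η : ℝ, 0 < η → η ≤ 1 / 100 →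
      ∀ (z : Fin 12 → EuclideanSpace ℝ (Fin 3)) (n : Fin 12 → ℝ),
        (∀ j, 1 ≤ ‖z j‖) →
        (∀ j, ‖z j‖ ≤ (1 + η) * min 1 (n j)) →
        (∀ j, n j ≤ ‖z j‖) →
        (∀ j k, j ≠ k → n j ≤ dist (z j) (z k)) →
        (∀ j, (Finset.univ.filter (fun k : Fin 12 =>
            k ≠ j ∧ dist (z j) (z k) ≤ (1 + η) * min (n j) (n k))).card = 4) →
        ∀ (A : EuclideanSpace ℝ (Fin 3) →ₗᵢ[ℝ] EuclideanSpace ℝ (Fin 3))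
          (P : Finset (EuclideanSpace ℝ (Fin 3))),
          (P = Literature.Geometry.DiscreteGeometry.fccKissingPattern ∨
            P = Literature.Geometry.DiscreteGeometry.hcpKissingPattern) →
          (∀ p ∈ P, ∃ j : Fin 12, dist (z j) (A p) ≤ 1 / 4) →
          ∀ p ∈ P, ∀ q ∈ P, ∀ j k : Fin 12,
            dist (z j) (A p) ≤ 1 / 4 → dist (z k) (A q) ≤ 1 / 4 → j ≠ k →
            dist (z j) (z k) ≤ (1 + η) * min (n j) (n k) → dist p q = 1) →
    ∀ η : ℝ, 0 < η → η ≤ 1 / 100 →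
      ∀ (N : ℕ) (y : Fin N → EuclideanSpace ℝ (Fin 3)) (j : Fin N),
        Literature.Geometry.DiscreteGeometry.IsChargeFree η y j →
        0 < Literature.Geometry.DiscreteGeometry.nearestDist y j →
        ∃ (P : Finset (EuclideanSpace ℝ (Fin 3)))
          (A : EuclideanSpace ℝ (Fin 3) →ₗᵢ[ℝ] EuclideanSpace ℝ (Fin 3))
          (m : EuclideanSpace ℝ (Fin 3) → Fin N),
          (P = Literature.Geometry.DiscreteGeometry.fccKissingPattern ∨
            P = Literature.Geometry.DiscreteGeometry.hcpKissingPattern) ∧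
          (∀ p ∈ P, (Literature.Geometry.DiscreteGeometry.bondGraph η y).Adj j (m p) ∧
            dist (y (m p)) (y j + Literature.Geometry.DiscreteGeometry.nearestDist y j • A p) ≤
              Literature.Geometry.DiscreteGeometry.nearestDist y j / 4) ∧
          (∀ p ∈ P, ∀ q ∈ P, m p = m q → p = q) ∧
          (∀ p ∈ P, ∀ q ∈ P,
            ((Literature.Geometry.DiscreteGeometry.bondGraph η y).Adj (m p) (m q) ↔ dist p q = 1)) ∧
          (∀ k, (Literature.Geometry.DiscreteGeometry.bondGraph η y).Adj j k → ∃ p ∈ P, m p = k) := by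
  exact Summit.AtomisticToContinuum.Crystallization.Theorems.stub_chartAssembly

/-- **stub_developReal** (M; provable now from the landed development).  The exact shadow
development on the REAL `(51/10)·nn_i`-ball: given `nn_i > 0`, charge-freeness within `8·nn_i`
and the labelled charts there, there are shadow positions `D : Fin N → ℝ³` such that at every site
`j` with `dist (y i) (y j) ≤ (51/10)·nn_i` the bond-neighbours of `j` are carried by `D` EXACTLY
onto a rotated FCC/HCP pattern about `D j`, the real bond vectors are within `nn_j/4` of `nn_j •`
a rotated copy of the shadow bond vectors, and bonds among neighbours of `j` are exactly the unit
distances of `D`.  Route: `Theorems.develop_reduction` with the penalised radial potential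
`f v = dist (y i) (y v) + (8/3) max 0 (nn_v − (53/50) nn_i)`, `R₁ = (129/25) nn_i`, `R₂ = 8 nn_i`
and the LANDED local hypotheses `develop_HO`, `develop_HX_fcc/hcp`, `develop_H1R` — exactly the
proof of `Theorems.develop_rest_of_orderedCaps`, keeping the conclusion on `{f ≤ R₁}` instead of
cutting it down to bond walks of length `≤ 5` (every `j` with `dist (y i) (y j) ≤ 5.1 nn_i` has
`nn_j ≤ 1.0825 nn_i` along a bond path of `≤ 7` steps, hence `f j ≤ R₁`).  The factor recovered is
`√(3/2)`: the walk `5`-ball guarantees abstract radius `4.08` only, the real `5.1`-ball ≈ `4.9`. -/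
theorem stub_developReal :
    ∀ η : ℝ, 0 < η → η ≤ 1 / 100 →
      ∀ (N : ℕ) (y : Fin N → EuclideanSpace ℝ (Fin 3)) (i : Fin N),
        0 < Literature.Geometry.DiscreteGeometry.nearestDist y i → (∀ j : Fin N, dist (y i) (y j) ≤ 8 * Literature.Geometry.DiscreteGeometry.nearestDist y i → Literature.Geometry.DiscreteGeometry.IsChargeFree η y j) → (∀ j : Fin N, dist (y i) (y j) ≤ 8 * Literature.Geometry.DiscreteGeometry.nearestDist y i → ∃ (P : Finset (EuclideanSpace ℝ (Fin 3))) (A : EuclideanSpace ℝ (Fin 3) →ₗᵢ[ℝ] EuclideanSpace ℝ (Fin 3)) (m : EuclideanSpace ℝ (Fin 3) → Fin N), (P = Literature.Geometry.DiscreteGeometry.fccKissingPattern ∨ P = Literature.Geometry.DiscreteGeometry.hcpKissingPattern) ∧ (∀ p ∈ P, (Literature.Geometry.DiscreteGeometry.bondGraph η y).Adj j (m p) ∧ dist (y (m p)) (y j + Literature.Geometry.DiscreteGeometry.nearestDist y j • A p) ≤ Literature.Geometry.DiscreteGeometry.nearestDist y j / 4) ∧ (∀ p ∈ P, ∀ q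 ∈ P, m p = m q → p = q) ∧ (∀ p ∈ P, ∀ q ∈ P, ((Literature.Geometry.DiscreteGeometry.bondGraph η y).Adj (m p) (m q) ↔ dist p q = 1)) ∧ (∀ k, (Literature.Geometry.DiscreteGeometry.bondGraph η y).Adj j k → ∃ p ∈ P, m p = k)) →
        ∃ D : Fin N → EuclideanSpace ℝ (Fin 3), (∀ j : Fin N, dist (y i) (y j) ≤ 51 / 10 * Literature.Geometry.DiscreteGeometry.nearestDist y i → ∃ (P : Finset (EuclideanSpace ℝ (Fin 3))) (Q R : EuclideanSpace ℝ (Fin 3) →ₗᵢ[ℝ] EuclideanSpace ℝ (Fin 3)), (P = Literature.Geometry.DiscreteGeometry.fccKissingPattern ∨ P = Literature.Geometry.DiscreteGeometry.hcpKissingPattern) ∧ D '' {k | (Literature.Geometry.DiscreteGeometry.bondGraph η y).Adj j k} = (fun p => D j + Q p) '' (P : Set (EuclideanSpace ℝ (Fin 3))) ∧ (∀ k, (Literature.Geometry.DiscreteGeometry.bondGraph η y).Adj j k → ‖(y k - y j) - Literature.Geometry.DiscreteGeometry.nearestDist y j • R (D k - D j)‖ ≤ Literature.Geometry.DiscreteGeometry.nearestDist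 y j / 4) ∧ (∀ k k', (Literature.Geometry.DiscreteGeometry.bondGraph η y).Adj j k → (Literature.Geometry.DiscreteGeometry.bondGraph η y).Adj j k' → ((Literature.Geometry.DiscreteGeometry.bondGraph η y).Adj k k' ↔ dist (D k) (D k') = 1))) := by
  sorry

/-- **stub_shadowCoarse** (L; COARSE metric control of the development — constants with a factor
≈ 2 of slack, NOT the sharp `1/6`).  For any shadow `D` developed on the real `(51/10)·nn_i`-ball:
(i) PACKING — distinct developed sites have shadow distance `≥ 1`; (ii) GLOBAL BOND-FAITHFULNESS —
two developed sites are bonded iff their shadow distance is exactly `1` (⇐: kissing number twelve,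
`FejesTothKissingTwelve`, plus (i)); (iii) INWARD TRACKING at radius `3` — `dist (D j) (D i) ≤
dist (y i) (y j)/nn_i + 1/4` (worst legitimate value ≈ `0.12`: `1 %/shell` inward scale drift
`0.06` + Möbius sagitta `0.045` + strain, sharing one `1 %` budget); (iv) OUTWARD TRACKING up to
shadow radius `4` — `dist (y i) (y j) ≤ (dist (D j) (D i) + 2/5)·nn_i` (worst ≈ `0.2`);
(v) SCALE DRIFT — `nn_j ≤ (11/10)·nn_i` there (`1.01` per bond, `≤ 7` bonds).  Route: chain the
landed cell identities (`metric_octahedron`, `metric_bipyramid`, `metric_scaled`) along shortest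
cell paths — the loose constants are what chaining delivers (lead: "chain-of-cells gives ≈ 0.3"
at radius `3` for the TWO-sided deviation; the one-sided radial quantities here are smaller). -/
theorem stub_shadowCoarse :
    ∀ η : ℝ, 0 < η → η ≤ 1 / 100 →
      ∀ (N : ℕ) (y : Fin N → EuclideanSpace ℝ (Fin 3)) (i : Fin N),
        0 < Literature.Geometry.DiscreteGeometry.nearestDist y i → (∀ j : Fin N, dist (y i) (y j) ≤ 8 * Literature.Geometry.DiscreteGeometry.nearestDist y i → Literature.Geometry.DiscreteGeometry.IsChargeFree η y j) →
        ∀ D : Fin N → EuclideanSpace ℝ (Fin 3), (∀ j : Fin N, dist (y i) (y j) ≤ 51 / 10 * Literature.Geometry.DiscreteGeometry.nearestDist y i → ∃ (P : Finset (EuclideanSpace ℝ (Fin 3))) (Q R : EuclideanSpace ℝ (Fin 3) →ₗᵢ[ℝ] EuclideanSpace ℝ (Fin 3)), (P = Literature.Geometry.DiscreteGeometry.fccKissingPattern ∨ P = Literature.Geometry.DiscreteGeometry.hcpKissingPattern) ∧ D '' {k | (Literature.Geometry.DiscreteGeometry.bondGraph η y).Adj j k} = (fun p => D j + Q p) ''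 (P : Set (EuclideanSpace ℝ (Fin 3))) ∧ (∀ k, (Literature.Geometry.DiscreteGeometry.bondGraph η y).Adj j k → ‖(y k - y j) - Literature.Geometry.DiscreteGeometry.nearestDist y j • R (D k - D j)‖ ≤ Literature.Geometry.DiscreteGeometry.nearestDist y j / 4) ∧ (∀ k k', (Literature.Geometry.DiscreteGeometry.bondGraph η y).Adj j k → (Literature.Geometry.DiscreteGeometry.bondGraph η y).Adj j k' → ((Literature.Geometry.DiscreteGeometry.bondGraph η y).Adj k k' ↔ dist (D k) (D k') = 1))) → ((∀ j k : Fin N, dist (y i) (y j) ≤ 51 / 10 * Literature.Geometry.DiscreteGeometry.nearestDist y i → dist (y i) (y k) ≤ 51 / 10 * Literature.Geometry.DiscreteGeometry.nearestDist y i → j ≠ k → 1 ≤ dist (D j) (D k)) ∧ (∀ j k : Fin N, dist (y i) (y j) ≤ 51 / 10 * Literature.Geometry.DiscreteGeometry.nearestDist y i → dist (y i) (y k) ≤ 51 / 10 * Literature.Geometry.DiscreteGeometry.nearestDist y i → ((Literature.Geometry.DiscreteGeometry.bondGraph η y).Adj j k ↔ dist (D j) (D k) = 1)) ∧ (∀ j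 : Fin N, dist (y i) (y j) ≤ 3 * Literature.Geometry.DiscreteGeometry.nearestDist y i → dist (D j) (D i) ≤ dist (y i) (y j) / Literature.Geometry.DiscreteGeometry.nearestDist y i + 1 / 4) ∧ (∀ j : Fin N, dist (y i) (y j) ≤ 51 / 10 * Literature.Geometry.DiscreteGeometry.nearestDist y i → dist (D j) (D i) ≤ 4 → dist (y i) (y j) ≤ (dist (D j) (D i) + 2 / 5) * Literature.Geometry.DiscreteGeometry.nearestDist y i) ∧ (∀ j : Fin N, dist (y i) (y j) ≤ 51 / 10 * Literature.Geometry.DiscreteGeometry.nearestDist y i → dist (D j) (D i) ≤ 4 → Literature.Geometry.DiscreteGeometry.nearestDist y j ≤ 11 / 10 * Literature.Geometry.DiscreteGeometry.nearestDist y i)) := by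
  sorry

/-- **stub_ballPropagationLow** (η = 0, exact; L; the STAIRCASE ENGINE — same vocabulary as the
landed `Theorems.stub_ballPropagation` (`13 → 7`), radii `71/10 → 13/2` in contact-`2` units, i.e.
`3.55·nn → 3.25·nn`).  If `u ∈ V`, `V` is a packing of unit balls, and every centre of `V` within
`71/10` of `u` has its tangent arrangement arranged in the FCC or in the HCP pattern, then inside
the closed `13/2`-ball about `u` the packing IS a rigid image of a Barlow stacking
`barlowStacking 2 (2√(2/3)) s`, `s` a Hägg sequence, and exhausts it there.  Why true: a finite
exact cluster with FCC/HCP shells develops rigidly; non-Barlow-ness of a ball needs foreign sites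
of TWO grains across two non-parallel coherent twin planes of the centre's grain; those planes
meet on a junction row whose sites have non-pattern shells (Σ3·Σ3 = Σ9: three coherent twins
never share a row), and the exact lattice geometry of that wedge (kit j023867: for every centre
with pattern shells out to `> 2.85·nn` the nearest pair of foreign grains is at `≥ √11·nn =
3.3166·nn`; first violation only when the shell radius drops to `2.83·nn`, the disprover's
T-junction `¬ SLP (14/5) 3 (1/6)`) gives the step; extra or missing points inside `13/2` are
excluded by the packing property and the exact shells out to `71/10 ≥ 13/2 + 0.6`.  Certifiable:
exact locally-Barlow clusters of radius `3.55` are finitely many up to isometry (two patterns,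
finitely many exact transitions per bond), so the statement is a finite enumeration over
developments — or prove the wedge inequality by hand (Hales DSP §1.3 order: h-discs propagate as
planes; two non-parallel h-planes meeting the `13/2`-ball intersect within the `71/10`-ball or
leave no room for both foreign layers). -/
theorem stub_ballPropagationLow : (∀ (V : Set (EuclideanSpace ℝ (Fin 3))) (u : EuclideanSpace ℝ (Fin 3)), u ∈ V → Literature.Geometry.DiscreteGeometry.IsUnitBallPacking V → (∀ v ∈ V, dist u v ≤ 71 / 10 → Literature.Geometry.DiscreteGeometry.IsArrangedIn (Literature.Geometry.DiscreteGeometry.kissingShell V v) Literature.Geometry.DiscreteGeometry.fccKissingPattern ∨ Literature.Geometry.DiscreteGeometry.IsArrangedIn (Literature.Geometry.DiscreteGeometry.kissingShell V v) Literature.Geometry.DiscreteGeometry.hcpKissingPattern) → ∃ s : ℤ → ℤ, Literature.MathematicalPhysics.StatisticalMechanics.IsHaggSeq s ∧ ∃ g : EuclideanSpace ℝ (Fin 3) ≃ᵢ EuclideanSpace ℝ (Fin 3), V ∩ Metric.closedBall u (13 / 2) = g '' Literature.MathematicalPhysics.StatisticalMechanics.barlowStacking 2 (2 * Real.sqrt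 (2 / 3)) s ∩ Metric.closedBall u (13 / 2)) := by
  sorry

/-- **stub_oneStackingLow** (M; formalisation step, provable now from its hypothesis `H0`).
Given the staircase engine `H0` (statement of `stub_ballPropagationLow`), charge-freeness within
`8·nn_i`, a shadow `D` developed on the real `(51/10)·nn_i`-ball and the five coarse facts of
`stub_shadowCoarse`: there are a Hägg sequence `s` and a rigid motion `φ` of shadow space such
that every developed site with shadow within `13/4` of `D i` is carried by `φ` INTO the unit
stacking `barlowStacking 1 √(2/3) s`, and every stacking point within `13/4` of `φ (D i)` is
`φ (D j)` for such a site (surjectivity).  Proof plan: `V := (2 • D ·) '' {developed sites}`,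
`u := 2 • D i`; `V` is a unit-ball packing by coarse (i); for a developed `j` with
`dist (D j) (D i) ≤ 71/20` every bond-neighbour `k` of `j` is developed (coarse (iv), (v):
`dist (y i) (y k) ≤ (71/20 + 2/5 + 1.01·11/10)·nn_i < 5.1·nn_i`), so by coarse (ii) and the exact
star of `j` the tangent arrangement `kissingShell V (2 • D j)` is `(2 • Q_j ·) '' P_j`, i.e.
`IsArrangedIn … P_j`; apply `H0`, rescale the isometry by `1/2` (Mazur–Ulam:
`IsometryEquiv.toRealAffineIsometryEquiv`) and read off membership and surjectivity from the set
identity on the closed `13/2`-ball. -/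
theorem stub_oneStackingLow :
    (∀ (V : Set (EuclideanSpace ℝ (Fin 3))) (u : EuclideanSpace ℝ (Fin 3)), u ∈ V → Literature.Geometry.DiscreteGeometry.IsUnitBallPacking V → (∀ v ∈ V, dist u v ≤ 71 / 10 → Literature.Geometry.DiscreteGeometry.IsArrangedIn (Literature.Geometry.DiscreteGeometry.kissingShell V v) Literature.Geometry.DiscreteGeometry.fccKissingPattern ∨ Literature.Geometry.DiscreteGeometry.IsArrangedIn (Literature.Geometry.DiscreteGeometry.kissingShell V v) Literature.Geometry.DiscreteGeometry.hcpKissingPattern) → ∃ s : ℤ → ℤ, Literature.MathematicalPhysics.StatisticalMechanics.IsHaggSeq s ∧ ∃ g : EuclideanSpace ℝ (Fin 3) ≃ᵢ EuclideanSpace ℝ (Fin 3), V ∩ Metric.closedBall u (13 / 2) = g '' Literature.MathematicalPhysics.StatisticalMechanics.barlowStacking 2 (2 * Real.sqrt (2 / 3)) s ∩ Metric.closedBall u (13 / 2)) →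
    ∀ η : ℝ, 0 < η → η ≤ 1 / 100 →
      ∀ (N : ℕ) (y : Fin N → EuclideanSpace ℝ (Fin 3)) (i : Fin N),
        0 < Literature.Geometry.DiscreteGeometry.nearestDist y i → (∀ j : Fin N, dist (y i) (y j) ≤ 8 * Literature.Geometry.DiscreteGeometry.nearestDist y i → Literature.Geometry.DiscreteGeometry.IsChargeFree η y j) →
        ∀ D : Fin N → EuclideanSpace ℝ (Fin 3), (∀ j : Fin N, dist (y i) (y j) ≤ 51 / 10 * Literature.Geometry.DiscreteGeometry.nearestDist y i → ∃ (P : Finset (EuclideanSpace ℝ (Fin 3))) (Q R : EuclideanSpace ℝ (Fin 3) →ₗᵢ[ℝ] EuclideanSpace ℝ (Fin 3)), (P = Literature.Geometry.DiscreteGeometry.fccKissingPattern ∨ P = Literature.Geometry.DiscreteGeometry.hcpKissingPattern) ∧ D '' {k | (Literature.Geometry.DiscreteGeometry.bondGraph η y).Adj j k} = (fun p => D j + Q p) '' (P : Set (EuclideanSpace ℝ (Fin 3))) ∧ (∀ k, (Literature.Geometry.DiscreteGeometry.bondGraph η y).Adj j k → ‖(y k - y j) - Literature.Geometry.DiscreteGeometry.nearestDist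 y j • R (D k - D j)‖ ≤ Literature.Geometry.DiscreteGeometry.nearestDist y j / 4) ∧ (∀ k k', (Literature.Geometry.DiscreteGeometry.bondGraph η y).Adj j k → (Literature.Geometry.DiscreteGeometry.bondGraph η y).Adj j k' → ((Literature.Geometry.DiscreteGeometry.bondGraph η y).Adj k k' ↔ dist (D k) (D k') = 1))) → ((∀ j k : Fin N, dist (y i) (y j) ≤ 51 / 10 * Literature.Geometry.DiscreteGeometry.nearestDist y i → dist (y i) (y k) ≤ 51 / 10 * Literature.Geometry.DiscreteGeometry.nearestDist y i → j ≠ k → 1 ≤ dist (D j) (D k)) ∧ (∀ j k : Fin N, dist (y i) (y j) ≤ 51 / 10 * Literature.Geometry.DiscreteGeometry.nearestDist y i → dist (y i) (y k) ≤ 51 / 10 * Literature.Geometry.DiscreteGeometry.nearestDist y i → ((Literature.Geometry.DiscreteGeometry.bondGraph η y).Adj j k ↔ dist (D j) (D k) = 1)) ∧ (∀ j : Fin N, dist (y i) (y j) ≤ 3 * Literature.Geometry.DiscreteGeometry.nearestDist y i → dist (D j) (D i) ≤ dist (y i) (y j) / Literature.Geometry.DiscreteGeometry.nearestDist y i + 1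 / 4) ∧ (∀ j : Fin N, dist (y i) (y j) ≤ 51 / 10 * Literature.Geometry.DiscreteGeometry.nearestDist y i → dist (D j) (D i) ≤ 4 → dist (y i) (y j) ≤ (dist (D j) (D i) + 2 / 5) * Literature.Geometry.DiscreteGeometry.nearestDist y i) ∧ (∀ j : Fin N, dist (y i) (y j) ≤ 51 / 10 * Literature.Geometry.DiscreteGeometry.nearestDist y i → dist (D j) (D i) ≤ 4 → Literature.Geometry.DiscreteGeometry.nearestDist y j ≤ 11 / 10 * Literature.Geometry.DiscreteGeometry.nearestDist y i)) →
        ∃ (s : ℤ → ℤ) (φ : EuclideanSpace ℝ (Fin 3) ≃ᵃⁱ[ℝ] EuclideanSpace ℝ (Fin 3)), Literature.MathematicalPhysics.StatisticalMechanics.IsHaggSeq s ∧ (∀ j : Fin N, dist (y i) (y j) ≤ 51 / 10 * Literature.Geometry.DiscreteGeometry.nearestDist y i → dist (D j) (D i) ≤ 13 / 4 → φ (D j) ∈ Literature.MathematicalPhysics.StatisticalMechanics.barlowStacking 1 (Real.sqrt (2 / 3)) s) ∧ (∀ z ∈ Literature.MathematicalPhysics.StatisticalMechanics.barlowStacking 1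 (Real.sqrt (2 / 3)) s, dist z (φ (D i)) ≤ 13 / 4 → ∃ j : Fin N, dist (y i) (y j) ≤ 51 / 10 * Literature.Geometry.DiscreteGeometry.nearestDist y i ∧ dist (D j) (D i) ≤ 13 / 4 ∧ φ (D j) = z) := by
  sorry

/-- **stub_licence** (XL; the SHARP metric step in LABEL form = the strategist's `LabelledLicence`
with container radius `4`).  Given the charge-free `8·nn_i`-ball and ANY Hägg sequence `s` and
labels `L` with: membership of the real `3·nn_i`-ball in the unit stacking, injectivity and exact
bond-faithfulness on the real `4·nn_i`-ball, and coverage of the stacking's `19/6`-ball about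
`L i` by labels of that ball — ONE rigid motion `g` has `dist (y j) (g (nn_i • L j)) ≤ nn_i/6`
for every site `j` of the `4·nn_i`-ball with real distance `≤ 3·nn_i` or label within `19/6` of
`L i`.  Any such labelling is induced by the geometry (links are rigid), so this is the discrete
Liouville/FJM inequality with an EXPLICIT constant that must be sharp within ≈ 1.5: legitimate
charge-free deformations are conformal ∘ affine (inversion centred at `≈ 200·nn`: `0.045·nn`;
uniform `2 %` strain: `0.056·nn`, the PROVED `¬ SLP 8 3 (1/20)`; lead/ideator LPs: `0.09–0.11·nn`
total at these radii) against `1/6`.  Intended proof: homogeneous-in-η form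
`dev ≤ (C₁ + C₂ η)·η·nn` with an LP/SDP DUAL certificate for `C₁` computed on the labelled
reference stacking (ideator-2 truss LP: `13.65/14.43` at `R = 3` against the budget `16.67`, all
Hägg words of `±10` layers) and a nonlinear remainder `C₂` from an a-priori rotation bound across
the ball (conformal group factored out); rational dual ⇒ `linear_combination`. -/
theorem stub_licence : ∀ η : ℝ, 0 < η → η ≤ 1 / 100 → ∀ (N : ℕ) (y : Fin N → EuclideanSpace ℝ (Fin 3)) (i : Fin N), (∀ j : Fin N, dist (y i) (y j) ≤ 8 * Literature.Geometry.DiscreteGeometry.nearestDist y i → Literature.Geometry.DiscreteGeometry.IsChargeFree η y j) → ∀ (s : ℤ → ℤ) (L : Fin N → EuclideanSpace ℝ (Fin 3)), Literature.MathematicalPhysics.StatisticalMechanics.IsHaggSeq s → (∀ j : Fin N, dist (y i) (y j) ≤ 3 * Literature.Geometry.DiscreteGeometry.nearestDist y i → L j ∈ Literature.MathematicalPhysics.StatisticalMechanics.barlowStacking 1 (Real.sqrt (2 / 3)) s) → (∀ j k : Fin N, dist (y i) (y j) ≤ 4 * Literature.Geometry.DiscreteGeometry.nearestDist y i → dist (y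 i) (y k) ≤ 4 * Literature.Geometry.DiscreteGeometry.nearestDist y i → L j = L k → j = k) → (∀ j k : Fin N, dist (y i) (y j) ≤ 4 * Literature.Geometry.DiscreteGeometry.nearestDist y i → dist (y i) (y k) ≤ 4 * Literature.Geometry.DiscreteGeometry.nearestDist y i → ((Literature.Geometry.DiscreteGeometry.bondGraph η y).Adj j k ↔ dist (L j) (L k) = 1)) → (∀ z ∈ Literature.MathematicalPhysics.StatisticalMechanics.barlowStacking 1 (Real.sqrt (2 / 3)) s, dist z (L i) ≤ 19 / 6 → ∃ j : Fin N, dist (y i) (y j) ≤ 4 * Literature.Geometry.DiscreteGeometry.nearestDist y i ∧ L j = z) → ∃ g : EuclideanSpace ℝ (Fin 3) ≃ᵃⁱ[ℝ] EuclideanSpace ℝ (Fin 3), ∀ j : Fin N, dist (y i) (y j) ≤ 4 * Literature.Geometry.DiscreteGeometry.nearestDist y i → (dist (y i) (y j) ≤ 3 * Literature.Geometry.DiscreteGeometry.nearestDist y i ∨ dist (L j) (L i) ≤ 19 / 6) → dist (y j) (g (Literature.Geometry.DiscreteGeometry.nearestDist y i • L j)) ≤ Literature.Geometry.DiscreteGeometry.nearestDist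 y i / 6 := by
  sorry

/-! ## Composition (no `sorry` below this line) -/

/-- **The line closes the crux.**  First the four clauses of the labelling (`hLab`, container
`4`): charts (landed `stub_chartAssembly`, `stub_linkEdges`, stub `stub_softLink`) →
`stub_developReal` → `stub_shadowCoarse` → `stub_oneStackingLow` fed `stub_ballPropagationLow` →
labels `L j := φ (D j)`.  Then the split glue (same proof as the strategist's
`Theorems.SoftLayerPropagation_of_subs`, `Cruxes/SoftLayerPropagation/SplitGlue.lean`, with
container `4` instead of `7/2`): `hLab` + `stub_licence` ⇒ the crux. -/
theorem SoftLayerPropagation_of :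
    Summit.AtomisticToContinuum.Crystallization.Theses.PricedLinkCensus.SoftLayerPropagation := by
  have hLab : ∀ η : ℝ, 0 < η → η ≤ 1 / 100 → ∀ (N : ℕ) (y : Fin N → EuclideanSpace ℝ (Fin 3)) (i : Fin N), (∀ j : Fin N, dist (y i) (y j) ≤ 8 * Literature.Geometry.DiscreteGeometry.nearestDist y i → Literature.Geometry.DiscreteGeometry.IsChargeFree η y j) → ∃ (s : ℤ → ℤ) (L : Fin N → EuclideanSpace ℝ (Fin 3)), Literature.MathematicalPhysics.StatisticalMechanics.IsHaggSeq s ∧ (∀ j : Fin N, dist (y i) (y j) ≤ 3 * Literature.Geometry.DiscreteGeometry.nearestDist y i → L j ∈ Literature.MathematicalPhysics.StatisticalMechanics.barlowStacking 1 (Real.sqrt (2 / 3)) s) ∧ (∀ j k : Fin N, dist (y i) (y j) ≤ 4 * Literature.Geometry.DiscreteGeometry.nearestDist y i → dist (y i) (y k) ≤ 4 * Literature.Geometry.DiscreteGeometry.nearestDist y i → L j = L k → j = k) ∧ (∀ j k : Fin N, dist (y i) (y j) ≤ 4 * Literature.Geometry.DiscreteGeometry.nearestDist y i → dist (y i) (y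 k) ≤ 4 * Literature.Geometry.DiscreteGeometry.nearestDist y i → ((Literature.Geometry.DiscreteGeometry.bondGraph η y).Adj j k ↔ dist (L j) (L k) = 1)) ∧ (∀ z ∈ Literature.MathematicalPhysics.StatisticalMechanics.barlowStacking 1 (Real.sqrt (2 / 3)) s, dist z (L i) ≤ 19 / 6 → ∃ j : Fin N, dist (y i) (y j) ≤ 4 * Literature.Geometry.DiscreteGeometry.nearestDist y i ∧ L j = z) := by
    intro η hη hη1 N y i hcf
    -- the centre is charge-free, hence has positive scale
    have hpos : 0 < nearestDist y i :=
      Summit.AtomisticToContinuum.Crystallization.Theorems.nearestDist_pos_of_ball_chargeFree hcf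
    -- charts at every site of the hypothesis ball
    have charts : ∀ j : Fin N, dist (y i) (y j) ≤ 8 * nearestDist y i → ∃ (P : Finset (EuclideanSpace ℝ (Fin 3))) (A : EuclideanSpace ℝ (Fin 3) →ₗᵢ[ℝ] EuclideanSpace ℝ (Fin 3)) (m : EuclideanSpace ℝ (Fin 3) → Fin N), (P = Literature.Geometry.DiscreteGeometry.fccKissingPattern ∨ P = Literature.Geometry.DiscreteGeometry.hcpKissingPattern) ∧ (∀ p ∈ P, (Literature.Geometry.DiscreteGeometry.bondGraph η y).Adj j (m p) ∧ dist (y (m p)) (y j + Literature.Geometry.DiscreteGeometry.nearestDist y j • A p) ≤ Literature.Geometry.DiscreteGeometry.nearestDist y j / 4) ∧ (∀ p ∈ P, ∀ q ∈ P, m p = m q → p = q) ∧ (∀ p ∈ P, ∀ q ∈ P, ((Literature.Geometry.DiscreteGeometry.bondGraph η y).Adj (m p) (m q) ↔ dist p q = 1)) ∧ (∀ k, (Literature.Geometry.DiscreteGeometry.bondGraph η y).Adj j k → ∃ p ∈ P, m p = k) :=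
      fun j hj => stub_chartAssembly stub_softLink stub_linkEdges η hη hη1 N y j (hcf j hj)
        (Summit.AtomisticToContinuum.Crystallization.Theorems.nearestDist_pos_of_isChargeFree (hcf j hj))
    -- the shadow on the real `5.1 nn`-ball, its coarse geometry, one stacking on the shadow `13/4`-ball
    obtain ⟨D, hD⟩ := stub_developReal η hη hη1 N y i hpos hcf charts
    have hC := stub_shadowCoarse η hη hη1 N y i hpos hcf D hD
    obtain ⟨hpack, hbondD, hin, hout, hscale⟩ := hC
    obtain ⟨s, φ, hs, hmemφ, hsurjφ⟩ :=
      stub_oneStackingLow stub_ballPropagationLow η hη hη1 N y i hpos hcf D hD ⟨hpack, hbondD, hin, hout, hscale⟩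
    -- labels
    refine ⟨s, fun j => φ (D j), hs, ?_, ?_, ?_, ?_⟩
    · -- membership on the real `3 nn`-ball: inward tracking puts the shadow within `13/4`
      intro j hj
      have h51 : dist (y i) (y j) ≤ 51 / 10 * nearestDist y i := by
        have : 3 * nearestDist y i ≤ 51 / 10 * nearestDist y i := by nlinarith
        exact hj.trans this
      refine hmemφ j h51 ?_
      have h1 := hin j hj
      have h2 : dist (y i) (y j) / nearestDist y i ≤ 3 := by
        rw [div_le_iff₀ hpos]; linarith
      linarith
    · -- injectivity on the real `4 nn`-ball: `φ` is injective and the shadow is a packing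
      intro j k hj hk hjk
      by_contra hne
      have h51j : dist (y i) (y j) ≤ 51 / 10 * nearestDist y i := by
        have : 4 * nearestDist y i ≤ 51 / 10 * nearestDist y i := by nlinarith
        exact hj.trans this
      have h51k : dist (y i) (y k) ≤ 51 / 10 * nearestDist y i := by
        have : 4 * nearestDist y i ≤ 51 / 10 * nearestDist y i := by nlinarith
        exact hk.trans this
      have h1 := hpack j k h51j h51k hne
      have h0 : D j = D k := φ.injective hjk
      rw [h0, dist_self] at h1
      linarith
    · -- bond-faithfulness on the real `4 nn`-ball: `φ` preserves distances
      intro j k hj hk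
      have h51j : dist (y i) (y j) ≤ 51 / 10 * nearestDist y i := by
        have : 4 * nearestDist y i ≤ 51 / 10 * nearestDist y i := by nlinarith
        exact hj.trans this
      have h51k : dist (y i) (y k) ≤ 51 / 10 * nearestDist y i := by
        have : 4 * nearestDist y i ≤ 51 / 10 * nearestDist y i := by nlinarith
        exact hk.trans this
      rw [AffineIsometryEquiv.dist_map]
      exact hbondD j k h51j h51k
    · -- coverage of the `19/6`-ball: surjectivity on the shadow `13/4`-ball, outward tracking
      intro z hz hzi
      have h134 : dist z (φ (D i)) ≤ 13 / 4 := by linarith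
      obtain ⟨j, hj51, hjD, hjz⟩ := hsurjφ z hz h134
      refine ⟨j, ?_, hjz⟩
      have h4 : dist (D j) (D i) ≤ 4 := by linarith
      have h1 := hout j hj51 h4
      nlinarith
  have hLic : ∀ η : ℝ, 0 < η → η ≤ 1 / 100 → ∀ (N : ℕ) (y : Fin N → EuclideanSpace ℝ (Fin 3)) (i : Fin N), (∀ j : Fin N, dist (y i) (y j) ≤ 8 * Literature.Geometry.DiscreteGeometry.nearestDist y i → Literature.Geometry.DiscreteGeometry.IsChargeFree η y j) → ∀ (s : ℤ → ℤ) (L : Fin N → EuclideanSpace ℝ (Fin 3)), Literature.MathematicalPhysics.StatisticalMechanics.IsHaggSeq s → (∀ j : Fin N, dist (y i) (y j) ≤ 3 * Literature.Geometry.DiscreteGeometry.nearestDist y i → L j ∈ Literature.MathematicalPhysics.StatisticalMechanics.barlowStacking 1 (Real.sqrt (2 / 3)) s) → (∀ j k : Fin N, dist (y i) (y j) ≤ 4 * Literature.Geometry.DiscreteGeometry.nearestDist y i → dist (y i) (y k) ≤ 4 * Literature.Geometry.DiscreteGeometry.nearestDist y i → L j = L k → j = k) → (∀ j k : Fin N,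 dist (y i) (y j) ≤ 4 * Literature.Geometry.DiscreteGeometry.nearestDist y i → dist (y i) (y k) ≤ 4 * Literature.Geometry.DiscreteGeometry.nearestDist y i → ((Literature.Geometry.DiscreteGeometry.bondGraph η y).Adj j k ↔ dist (L j) (L k) = 1)) → (∀ z ∈ Literature.MathematicalPhysics.StatisticalMechanics.barlowStacking 1 (Real.sqrt (2 / 3)) s, dist z (L i) ≤ 19 / 6 → ∃ j : Fin N, dist (y i) (y j) ≤ 4 * Literature.Geometry.DiscreteGeometry.nearestDist y i ∧ L j = z) → ∃ g : EuclideanSpace ℝ (Fin 3) ≃ᵃⁱ[ℝ] EuclideanSpace ℝ (Fin 3), ∀ j : Fin N, dist (y i) (y j) ≤ 4 * Literature.Geometry.DiscreteGeometry.nearestDist y i → (dist (y i) (y j) ≤ 3 * Literature.Geometry.DiscreteGeometry.nearestDist y i ∨ dist (L j) (L i) ≤ 19 / 6) → dist (y j) (g (Literature.Geometry.DiscreteGeometry.nearestDist y i • L j)) ≤ Literature.Geometry.DiscreteGeometry.nearestDist y i / 6 := stub_licence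
  -- the split glue
  unfold Summit.AtomisticToContinuum.Crystallization.Theses.PricedLinkCensus.SoftLayerPropagation
  intro η hη hη1 N y i hcf
  have hpos : 0 < nearestDist y i :=
    Summit.AtomisticToContinuum.Crystallization.Theorems.nearestDist_pos_of_ball_chargeFree hcf
  obtain ⟨s, L, hs, hmem, hinj, hbond, hcov⟩ := hLab η hη hη1 N y i hcf
  obtain ⟨g, hg⟩ := hLic η hη hη1 N y i hcf s L hs hmem hinj hbond hcov
  refine ⟨s, g, hs, ?_, ?_⟩
  · intro j hj
    have hj4 : dist (y i) (y j) ≤ 4 * nearestDist y i := by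
      have h34 : 3 * nearestDist y i ≤ 4 * nearestDist y i := by nlinarith
      exact hj.trans h34
    exact ⟨nearestDist y i • L j,
      Summit.AtomisticToContinuum.Crystallization.Theorems.smul_mem_barlowStacking (hmem j hj),
      hg j hj4 (Or.inl hj)⟩
  · intro z hz hzi
    obtain ⟨x, hx, rfl⟩ :=
      Summit.AtomisticToContinuum.Crystallization.Theorems.exists_eq_smul_of_mem_barlowStacking hz
    have hi4 : dist (y i) (y i) ≤ 4 * nearestDist y i := by
      rw [dist_self]; positivity
    have hi3 : dist (y i) (y i) ≤ 3 * nearestDist y i := by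
      rw [dist_self]; positivity
    have hgi := hg i hi4 (Or.inl hi3)
    have hdist : dist (nearestDist y i • x) (nearestDist y i • L i) =
        nearestDist y i * dist x (L i) := by
      rw [dist_smul₀, Real.norm_eq_abs, abs_of_pos hpos]
    have hx13 : dist x (L i) ≤ 19 / 6 := by
      have h1 : dist (g (nearestDist y i • x)) (g (nearestDist y i • L i)) ≤
          dist (g (nearestDist y i • x)) (y i) + dist (y i) (g (nearestDist y i • L i)) :=
        dist_triangle _ _ _
      rw [AffineIsometryEquiv.dist_map, hdist, dist_comm (g (nearestDist y i • x)) (y i)] at h1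
      have h3 : nearestDist y i * dist x (L i) ≤ nearestDist y i * (19 / 6) := by linarith
      exact le_of_mul_le_mul_left h3 hpos
    obtain ⟨j, hj4, hjx⟩ := hcov x hx hx13
    refine ⟨j, ?_⟩
    have hlab : dist (L j) (L i) ≤ 19 / 6 := by rw [hjx]; exact hx13
    have := hg j hj4 (Or.inr hlab)
    rwa [hjx] at this

end Summit.AtomisticToContinuum.Crystallization.Cruxes.SoftLayerPropagation.TwinCone

end
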